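import Summits.CriticalPhenomena.SAWScalingLimit.Theses.SAWFrontierHomotopy
import Summits.CriticalPhenomena.SAWScalingLimit.Theorems.SAWChargeContinuationSAWAvoidanceLawOfScalingLimit

/-!
# `OneSidedPowerLaw` is NECESSARY for the sub-problem (line `birth`, lead c1 audit)

Crux `Summit.CriticalPhenomena.SAWScalingLimit.Theses.SAWFrontierHomotopy.OneSidedPowerLaw`
(item stmt-CriticalPhenomena-10702). The registered skeleton `Lines/birth.lean` proves
`OneSidedPowerLaw ↔ Registered.stub_plusPowerLaw` (the one open stub). This file certifies, kernel-checked
and sorry-free, that the crux (hence the stub) is a CONSEQUENCE of the sub-problem statement itself: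

* `oneSidedPowerLaw_of_avoidanceLimit : SAWLoopFugacityFlow.AvoidanceLimit → OneSidedPowerLaw` (α = 5/8) — the
  crux is formally below the closed-range avoidance crux of route SAWLoopFugacityFlow (stmt-CriticalPhenomena-4981):
  the five hull-subdomain clauses of the crux ARE `MarkedDomain.IsHullSubdomain` (definitionally), which gives the
  ball clause of `AvoidanceLimit` (`exists_ball_inter_eq`); the one-sidedness hypothesis is simply dropped;
* `oneSidedPowerLaw_of_sawScalingLimit : SAWScalingLimit → OneSidedPowerLaw` — by the tree's
  `SAWChargeContinuation.avoidanceLimit_of_sawScalingLimit` (portmanteau sandwich + [LSW] Thm. 6.1 for the SLE_{8/3}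
  law + the null touching event), so refuting the crux refutes the conjunct as typed, and the crux is a genuine
  waypoint (not harder than the target): `SAWScalingLimit → OneSidedPowerLaw → (route) → SAWScalingLimit`.

Sources: LawlerSchrammWerner2003Restriction Thm. 6.1 (arXiv:math/0209343 p. 23); LawlerSchrammWerner2004SAW §4.1.
-/

noncomputable section

open scoped Topology ENNReal NNReal
open Filter Set MeasureTheory
open UpperHalfPlane (upperHalfPlaneSet)
open Literature.Probability.RandomPlanarGeometry Literature.Probability.LatticeModels
open Summit.CriticalPhenomena.SAWScalingLimit.Theses.SAWFrontierHomotopy (OneSidedPowerLaw)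
open Summit.CriticalPhenomena.SAWScalingLimit.Theses.SAWLoopFugacityFlow (AvoidanceLimit)

namespace Summit.CriticalPhenomena.SAWScalingLimit.Cruxes.OneSidedPowerLaw.Birth

/-- **`AvoidanceLimit → OneSidedPowerLaw` with `α = 5/8`.** The closed-range avoidance crux of route
SAWLoopFugacityFlow (two-sided hulls, value `Φ'_A(0)^{5/8}`) implies the one-sided power law: the crux's five
hull-subdomain clauses are `MarkedDomain.IsHullSubdomain D D'` by definition, whence the ball clause of
`AvoidanceLimit`; the `IsPlusHull ∨ IsMinusHull` hypothesis is not needed. [cite: LawlerSchrammWerner2004SAW, §4.1 Prediction 1] -/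
theorem oneSidedPowerLaw_of_avoidanceLimit (h : AvoidanceLimit) : OneSidedPowerLaw := by
  refine ⟨(5 : ℝ) / 8, ?_⟩
  intro D a b hab D' hsub φ hφ _ Φ d hΦ hd
  have hHull : D.IsHullSubdomain D' := hsub
  exact h D D' a b hab hHull.carrier_subset hHull.pt_zero_eq hHull.pt_one_eq
    (Theorems.SimpleSubseqLimits.MarkedPointRevisit.ArcRangeBoundary.exists_ball_inter_eq hHull)
    φ hφ _ rfl Φ d hΦ hd

/-- **`SAWScalingLimit → OneSidedPowerLaw`: the crux is necessary for the sub-problem.** If the critical planar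
SAW converges in law to chordal SLE_{8/3} (the conjunct `SAWScalingLimit` as typed), then the one-sided power law
holds with `α = 5/8`, through `SAWChargeContinuation.avoidanceLimit_of_sawScalingLimit` ([LSW] Thm. 6.1 for the
limit law, portmanteau sandwich, null touching event). [cite: LawlerSchrammWerner2003Restriction, Thm. 6.1 (p. 23)] -/
theorem oneSidedPowerLaw_of_sawScalingLimit (hS : _root_.SAWScalingLimit) : OneSidedPowerLaw :=
  oneSidedPowerLaw_of_avoidanceLimit (Theorems.SAWChargeContinuation.avoidanceLimit_of_sawScalingLimit hS)

/-- Contrapositive, the form a disprover uses: **a refutation of the crux refutes the conjunct as typed.** [folklore] -/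
theorem not_sawScalingLimit_of_not_oneSidedPowerLaw (h : ¬ OneSidedPowerLaw) : ¬ _root_.SAWScalingLimit :=
  fun hS => h (oneSidedPowerLaw_of_sawScalingLimit hS)

end Summit.CriticalPhenomena.SAWScalingLimit.Cruxes.OneSidedPowerLaw.Birth

end
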